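import Literature.Probability.LatticeModels.GibbsTailTriviality
import Literature.Probability.LatticeModels.IsingFKG
import Literature.Probability.LatticeModels.GibbsSpecificationProofs
import HarnessLib

/-!
# Tail-trivial Gibbs measures: finite-volume approximation and positive correlations

Topic `Probability/LatticeModels`; theorems only. Fourth infrastructure file toward the
Aizenman–Higuchi theorem along Georgii–Higuchi 2000, whose §2 (p. 3) uses "the fact that
extremal Gibbs measures have positive correlations" and, throughout, limits `Λ ↑ ℤ²` of
finite-volume Gibbs distributions `μ^ω_Λ` under an extremal `μ` (Georgii 2011, Thm. 7.12:
for `μ ∈ ex 𝒢(γ)`, `γ_Λ(A|·) → μ(A)` `μ`-a.s. along the volumes).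

* `IsTailTrivial.condExp_tailEvents_ae_eq_const` — for a tail-trivial probability measure,
  `μ[f | 𝒯] = μ(f)` a.s.
* `IsGibbsMeasure.exists_strictMono_ae_tendsto_integral_spec` — for a tail-trivial
  `μ ∈ 𝒢(γ)`, an increasing exhausting sequence of volumes `Λ_n` and a bounded measurable `f`:
  `γ_{Λ_{φ j}}(f|ω) → μ(f)` for `μ`-a.e. `ω` along a subsequence `φ` (Georgii 2011, Thm. 7.12,
  subsequence form; from Lévy's downward theorem `Process.exists_strictMono_ae_tendsto_condExp_antitone`
  and the DLR identity `γ_Λ(f|·) = μ(f | 𝓕_{Λᶜ})`).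
* **`isingGibbs_integral_mul_ge_of_isTailTrivial`** — positive correlations (FKG) of
  tail-trivial infinite-volume Ising Gibbs measures on `ℤ^d`, `β ≥ 0`, any `h`: for bounded
  measurable nondecreasing `f, g`, `μ(f) μ(g) ≤ μ(f g)` (Georgii–Higuchi 2000, §2, p. 3;
  Friedli–Velenik 2017, Thm. 3.21 in finite volume): `μ(fg) = ∫ γ_Λ(fg|ω) μ(dω) ≥
  ∫ γ_Λ(f|ω) γ_Λ(g|ω) μ(dω) → μ(f) μ(g)` (finite-volume FKG `ising_fkg_holds` with boundary
  condition `ω`, DLR, dominated convergence along the subsequence).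

## References

* H.-O. Georgii, Y. Higuchi, J. Math. Phys. 41 (2000) 1153–1169, §2, p. 3 [GeorgiiHiguchi2000].
* H.-O. Georgii, *Gibbs Measures and Phase Transitions*, 2nd ed. 2011, Thm. 7.12 [Georgii2011].
* S. Friedli, Y. Velenik, *Statistical Mechanics of Lattice Systems*, CUP 2017, Thm. 3.21
  [FriedliVelenik2017].
-/

noncomputable section

open MeasureTheory ProbabilityTheory Filter
open scoped ENNReal ProbabilityTheory Topology

namespace Literature.Probability.LatticeModels

variable {V S : Type*} [MeasurableSpace S]

/-! ### Conditional expectations given a trivial tail -/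

/-- For a **tail-trivial** probability measure the conditional expectation given the tail
σ-algebra is the expectation: `μ[f | 𝒯] = μ(f)` a.s. (both sides have the same integrals over
tail events, which have probability `0` or `1`) (Georgii 2011, Thm. 7.7 / Prop. 7.9). [cite: Georgii2011, Thm. 7.7] -/
theorem IsTailTrivial.condExp_tailEvents_ae_eq_const {μ : Measure (V → S)} [IsProbabilityMeasure μ]
    (hμ : IsTailTrivial μ) {f : (V → S) → ℝ} (hf : Integrable f μ) :
    μ[f|tailEvents V S] =ᵐ[μ] fun _ => ∫ x, f x ∂μ := by
  have hm : tailEvents V S ≤ (MeasurableSpace.pi : MeasurableSpace (V → S)) := tailEvents_le_pi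
  refine (ae_eq_condExp_of_forall_setIntegral_eq hm hf (fun s _ _ => (integrable_const _).integrableOn)
    (fun s hs _ => ?_) (stronglyMeasurable_const.aestronglyMeasurable)).symm
  have hsm : MeasurableSet s := hm _ hs
  rcases hμ s hs with h0 | h1
  · rw [setIntegral_const, Measure.restrict_eq_zero.2 h0]
    simp [measureReal_def, h0]
  · have hsc : μ sᶜ = 0 := (prob_compl_eq_zero_iff hsm).2 h1
    have hres : μ.restrict s = μ := Measure.restrict_eq_self_of_ae_mem (ae_iff.2 hsc)
    rw [hres, integral_const, smul_eq_mul, measureReal_def, measure_univ, ENNReal.toReal_one, one_mul]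

/-! ### Finite-volume kernels converge to a tail-trivial Gibbs measure along a subsequence -/

variable {γ : Specification V S}

/-- **Finite-volume approximation of a tail-trivial Gibbs measure** (Georgii 2011, Thm. 7.12,
subsequence form): if `μ ∈ 𝒢(γ)` is tail trivial, `Λ_n` is an increasing exhausting sequence
of finite volumes and `f` is bounded and measurable, then along some subsequence `φ`,
`∫ f dγ_{Λ_{φ j}}(·|ω) → ∫ f dμ` for `μ`-a.e. `ω`. Proof: `γ_Λ(f|·) = μ(f|𝓕_{Λᶜ})` a.s. (DLR),
`μ(f|𝓕_{Λ_nᶜ}) → μ(f|𝒯)` a.s. along a subsequence (Lévy's downward theorem), and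
`μ(f|𝒯) = μ(f)` by tail triviality. [cite: Georgii2011, Thm. 7.12] -/
theorem IsGibbsMeasure.exists_strictMono_ae_tendsto_integral_spec (hγ : IsSpecification γ)
    {μ : Measure (V → S)} (hμ : IsGibbsMeasure γ μ) (hμt : IsTailTrivial μ)
    {Λ : ℕ → Finset V} (hΛmono : Monotone Λ) (hΛex : ∀ Δ : Finset V, ∃ n, Δ ⊆ Λ n)
    {f : (V → S) → ℝ} (hfm : Measurable f) {C : ℝ} (hfC : ∀ σ, |f σ| ≤ C) :
    ∃ φ : ℕ → ℕ, StrictMono φ ∧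
      ∀ᵐ ω ∂μ, Tendsto (fun j => ∫ σ, f σ ∂(γ (Λ (φ j)) ω)) atTop (𝓝 (∫ σ, f σ ∂μ)) := by
  haveI := hμ.isProbabilityMeasure
  set ℱ : ℕ → MeasurableSpace (V → S) :=
    fun n => cylinderEvents (X := fun _ : V => S) ((↑(Λ n) : Set V)ᶜ) with hℱ
  have hℱanti : Antitone ℱ := fun n k hnk =>
    cylinderEvents_mono (Set.compl_subset_compl.2 (Finset.coe_subset.2 (hΛmono hnk)))
  have hℱle : ∀ n, ℱ n ≤ (MeasurableSpace.pi : MeasurableSpace (V → S)) := fun n =>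
    cylinderEvents_le_pi
  have hℱinf : (⨅ n, ℱ n) = tailEvents V S := (tailEvents_eq_iInf_of_exhaustion hΛex).symm
  have hf_int : Integrable f μ := (integrable_const C).mono' hfm.aestronglyMeasurable
    (ae_of_all _ fun σ => by rw [Real.norm_eq_abs]; exact hfC σ)
  obtain ⟨φ, hφ, hlim⟩ :=
    Literature.Probability.Process.exists_strictMono_ae_tendsto_condExp_antitone hℱanti hℱle
      hf_int (ae_of_all _ hfC)
  refine ⟨φ, hφ, ?_⟩
  have hterm : ∀ n, μ[f|ℱ n] =ᵐ[μ] fun η => ∫ σ, f σ ∂(γ (Λ n) η) := fun n =>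
    hμ.condExp_ae_eq_integral hγ (Λ n) hfm hfC
  have hall : ∀ᵐ ω ∂μ, ∀ n, (μ[f|ℱ n]) ω = ∫ σ, f σ ∂(γ (Λ n) ω) := ae_all_iff.2 hterm
  have hlimit : μ[f|⨅ n, ℱ n] =ᵐ[μ] fun _ => ∫ σ, f σ ∂μ := by
    rw [hℱinf]
    exact hμt.condExp_tailEvents_ae_eq_const hf_int
  filter_upwards [hlim, hall, hlimit] with ω hω hωn hω'
  have h1 : (fun j => (μ[f|ℱ (φ j)]) ω) = fun j => ∫ σ, f σ ∂(γ (Λ (φ j)) ω) :=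
    funext fun j => hωn (φ j)
  rw [← h1, ← hω']
  exact hω

/-! ### Positive correlations of tail-trivial Ising Gibbs measures -/

section Ising

variable {d : ℕ} {β h : ℝ}

/-- **Tail-trivial infinite-volume Ising Gibbs measures have positive correlations (FKG)**
(Georgii–Higuchi 2000, §2, p. 3: "extremal Gibbs measures have positive correlations";
Friedli–Velenik 2017, Thm. 3.21 for the finite-volume inequality): for the nearest-neighbour
Ising model on `ℤ^d` with `β ≥ 0`, any field `h`, a tail-trivial `μ ∈ 𝒢(β, h)` and bounded
measurable nondecreasing `f, g`: `∫ f dμ · ∫ g dμ ≤ ∫ f g dμ`. Proof: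
`μ(fg) = ∫ γ_Λ(fg|ω) μ(dω) ≥ ∫ γ_Λ(f|ω) γ_Λ(g|ω) μ(dω)` (DLR; finite-volume FKG with boundary
condition `ω`, `ising_fkg_holds`) and the right side tends to `μ(f) μ(g)` along the subsequence of
`IsGibbsMeasure.exists_strictMono_ae_tendsto_integral_spec` (dominated convergence). [cite: GeorgiiHiguchi2000, §2 p. 3] -/
theorem isingGibbs_integral_mul_ge_of_isTailTrivial (hβ : 0 ≤ β) {μ : Measure (SpinConfig (Site d))}
    (hμ : μ ∈ isingGibbsMeasures d β h) (hμt : IsTailTrivial μ)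
    {f g : SpinConfig (Site d) → ℝ} (hf : Monotone f) (hg : Monotone g)
    (hfm : Measurable f) (hgm : Measurable g) {Cf Cg : ℝ} (hfC : ∀ σ, |f σ| ≤ Cf)
    (hgC : ∀ σ, |g σ| ≤ Cg) :
    (∫ σ, f σ ∂μ) * (∫ σ, g σ ∂μ) ≤ ∫ σ, f σ * g σ ∂μ := by
  have hγ : IsSpecification (isingSpecification (zdGraph d) β h) :=
    isSpecification_isingSpecification_zd_holds d β h
  have hμG : IsGibbsMeasure (isingSpecification (zdGraph d) β h) μ := hμ
  haveI := hμG.isProbabilityMeasure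
  obtain ⟨Λ, hΛmono, hΛex⟩ := exists_monotone_finset_exhaustion (Site d)
  -- a common subsequence along which both finite-volume expectations converge a.e.
  obtain ⟨φ₁, hφ₁, hlimf⟩ := hμG.exists_strictMono_ae_tendsto_integral_spec hγ hμt hΛmono hΛex hfm hfC
  have hΛ'mono : Monotone (Λ ∘ φ₁) := hΛmono.comp hφ₁.monotone
  have hΛ'ex : ∀ Δ : Finset (Site d), ∃ n, Δ ⊆ (Λ ∘ φ₁) n := fun Δ => by
    obtain ⟨n, hn⟩ := hΛex Δ
    exact ⟨n, hn.trans (hΛmono (hφ₁.id_le n))⟩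
  obtain ⟨φ₂, hφ₂, hlimg⟩ :=
    hμG.exists_strictMono_ae_tendsto_integral_spec hγ hμt hΛ'mono hΛ'ex hgm hgC
  set ψ : ℕ → ℕ := φ₁ ∘ φ₂ with hψ
  set γ' := isingSpecification (zdGraph d) β h with hγ'
  have hlimf' : ∀ᵐ ω ∂μ, Tendsto (fun j => ∫ σ, f σ ∂(γ' (Λ (ψ j)) ω)) atTop (𝓝 (∫ σ, f σ ∂μ)) := by
    filter_upwards [hlimf] with ω hω
    exact hω.comp hφ₂.tendsto_atTop
  -- integrability and bounds of the finite-volume expectations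
  have hprob : ∀ (Δ : Finset (Site d)) ω, IsProbabilityMeasure (γ' Δ ω) := fun Δ ω =>
    hγ.isProbability Δ ω
  have hbound : ∀ {u : SpinConfig (Site d) → ℝ} {C : ℝ}, (∀ σ, |u σ| ≤ C) →
      ∀ (Δ : Finset (Site d)) ω, |∫ σ, u σ ∂(γ' Δ ω)| ≤ C := by
    intro u C huC Δ ω
    haveI := hprob Δ ω
    have h1 : ‖∫ σ, u σ ∂(γ' Δ ω)‖ ≤ C * (γ' Δ ω).real Set.univ :=
      norm_integral_le_of_norm_le_const (ae_of_all _ fun σ => by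
        rw [Real.norm_eq_abs]; exact huC σ)
    rwa [probReal_univ, mul_one, Real.norm_eq_abs] at h1
  have hmeas : ∀ {u : SpinConfig (Site d) → ℝ}, Measurable u → ∀ Δ : Finset (Site d),
      Measurable fun ω => ∫ σ, u σ ∂(γ' Δ ω) := by
    intro u hu Δ
    have hsm := hu.stronglyMeasurable.integral_kernel (κ := hγ.toKernel Δ)
    exact (hsm.mono cylinderEvents_le_pi).measurable
  -- the finite-volume inequality integrated against `μ`
  have hstep : ∀ j, ∫ ω, (∫ σ, f σ ∂(γ' (Λ (ψ j)) ω)) * (∫ σ, g σ ∂(γ' (Λ (ψ j)) ω)) ∂μ ≤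
      ∫ σ, f σ * g σ ∂μ := by
    intro j
    set Δ := Λ (ψ j) with hΔ
    have hfg_m : Measurable fun σ => f σ * g σ := hfm.mul hgm
    have hfg_b : ∀ σ, |f σ * g σ| ≤ Cf * Cg := fun σ => by
      rw [abs_mul]; exact mul_le_mul (hfC σ) (hgC σ) (abs_nonneg _) ((abs_nonneg _).trans (hfC σ))
    have hfg_int : Integrable (fun σ => f σ * g σ) μ := (integrable_const (Cf * Cg)).mono'
      hfg_m.aestronglyMeasurable (ae_of_all _ fun σ => by rw [Real.norm_eq_abs]; exact hfg_b σ)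
    have hDLR : ∫ ω, ∫ σ, f σ * g σ ∂(γ' Δ ω) ∂μ = ∫ σ, f σ * g σ ∂μ :=
      hμG.integral_integral_eq hγ Δ hfg_int
    rw [← hDLR]
    refine integral_mono ?_ ?_ fun ω => ?_
    · refine (integrable_const (Cf * Cg)).mono' ((hmeas hfm Δ).mul (hmeas hgm Δ)).aestronglyMeasurable
        (ae_of_all _ fun ω => ?_)
      rw [Real.norm_eq_abs, abs_mul]
      exact mul_le_mul (hbound hfC Δ ω) (hbound hgC Δ ω) (abs_nonneg _)
        ((abs_nonneg _).trans (hbound hfC Δ ω))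
    · refine (integrable_const (Cf * Cg)).mono' (hmeas hfg_m Δ).aestronglyMeasurable
        (ae_of_all _ fun ω => ?_)
      rw [Real.norm_eq_abs]
      exact hbound hfg_b Δ ω
    · -- finite-volume FKG with boundary condition `ω`
      have := ising_fkg_holds (zdGraph d) hβ Δ h (.fixed ω) f g hf hg hfm hgm
      simpa [isingExpect, hγ', isingSpecification_apply] using this
  -- pass to the limit along `ψ`
  have hlim : Tendsto (fun j => ∫ ω, (∫ σ, f σ ∂(γ' (Λ (ψ j)) ω)) * (∫ σ, g σ ∂(γ' (Λ (ψ j)) ω)) ∂μ)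
      atTop (𝓝 (∫ ω, (∫ σ, f σ ∂μ) * (∫ σ, g σ ∂μ) ∂μ)) := by
    refine tendsto_integral_of_dominated_convergence (fun _ => Cf * Cg)
      (fun j => ((hmeas hfm _).mul (hmeas hgm _)).aestronglyMeasurable) (integrable_const _)
      (fun j => ae_of_all _ fun ω => ?_) ?_
    · rw [Real.norm_eq_abs, abs_mul]
      exact mul_le_mul (hbound hfC (Λ (ψ j)) ω) (hbound hgC (Λ (ψ j)) ω) (abs_nonneg _)
        ((abs_nonneg _).trans (hbound hfC (Λ (ψ j)) ω))
    · filter_upwards [hlimf', hlimg] with ω hωf hωg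
      exact hωf.mul hωg
  have hconst : ∫ ω, (∫ σ, f σ ∂μ) * (∫ σ, g σ ∂μ) ∂μ = (∫ σ, f σ ∂μ) * (∫ σ, g σ ∂μ) := by
    rw [integral_const, smul_eq_mul, measureReal_def, measure_univ, ENNReal.toReal_one, one_mul]
  rw [← hconst]
  exact le_of_tendsto' hlim hstep

end Ising

end Literature.Probability.LatticeModels
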